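import Summits.ABC.IUTFork.Cor312StatementStability
import Summits.ABC.IUTFork.Cor312StepXIdeReal
import Mathlib.Order.Filter.Cofinite
import HarnessLib

/-!
# [IUTchIII] Corollary 3.12, statement — `ThetaFinite` ("`−|log(Θ)| ∈ ℝ`") for settings assembled over real packets

Record-only file (D-0012) of the abc-iut cell (Cor. 3.12 sub-crew, seat abc-iut-c312-7, gen 2; the leftover
«ThetaFinite» of TEAM A row A-0, `HOME/plan/C312-TEAMS.md`, named by seat c312-5 2026-08-26T00:52:17Z); TAKES NO
SIDE. The first clause of the conclusion of [IUTchIII] Cor. 3.12 (S. Mochizuki, *Inter-universal Teichmüller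
theory III*, kurims manuscript `paper:url-4b091feeb646`, statement p. 173 l. 41 – p. 174 l. 19), "`−|log(Θ)| ∈ ℝ`",
is typed in `Cor312Statement.lean` as `Cor312.Setting.ThetaFinite`: (a) at every label `j ∈ 𝔽_l^⋇` and every
`v_ℚ` the union of the possible images of the Θ-pilot object admits its holomorphic hull (`HullDefined`; the printed
"one concludes easily from the [easily verified] compactness of the `^{1,∘}𝒰_{j,v_ℚ}` … that the quantity `−|log(Θ)|`
is finite", proof of Cor. 3.12, p. 175 l. 2–4) and (b) for each label the hull log-volumes vanish at all but
finitely many `v_ℚ` ([IUTchIII] Prop. 3.9 (iii), p. 117: "all but finitely many of which are zero").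
`Cor312StatementStability.lean` reduced (a) to lattice stability (`hullDefined_of_stable`). THIS FILE finishes the
bookkeeping for settings assembled by `Setting.ofComparison` (`Cor312SettingReal.lean`: hull frame = the REAL frame of
`⊕_i K_i` pulled back along the comparison `e`, Θ-images = preimages `e⁻¹(thetaBox m)`), PROVING:

* `image_preimage_eq_of_semiconj` — DESCENT ⟹ STABILITY: if a packet automorphism `Φ` descends along `e` to an
  injective `Ψ` (`e ∘ Φ = Ψ ∘ e`, the shape of seat c312-5's `Cor312Vol.SummandPieces.GeneratorsPreserve.family`:
  "intertwined by the comparison") and `Ψ` maps `Λ` onto itself, then `Φ` maps `e⁻¹(Λ)` onto itself — pure set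
  algebra, no saturation `e⁻¹(e(W)) = W` of any lattice is needed;
* `hullDefined_of_descent` — (a) at `(j, v_ℚ)` from: every (Ind1)/(Ind2) family descends along `e` to an injection
  fixing a BOUNDED `Λ ⊆ ⊕_i K_i` containing all the Θ-boxes (Dupuy–Hilado §4 intro: "elements of Ind1 are just
  automorphisms … induced by automorphisms of the `ℤ_p`-lattice", "the Ind2 indeterminacies also preserve this
  lattice"; (Ind3) ⊆ log-shell: [IUTchIII] Prop. 3.5 (ii), Dupuy–Hilado (4.10)), plus non-degeneracy of the part
  of the Θ-boxes met by the image of `e`;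
* `hullDefined_and_thetaHull_eq_of_isHullSet` — THE GOOD PLACES: if the (Ind3)-region `thetaRegion3 = e⁻¹(⋃ₘ thetaBox m)`
  is itself stable under the families and its image is a hull-set `λ·𝒪_L`, then `^{n,∘}𝒰_{j,v_ℚ}` IS `thetaRegion3`
  (a hull-set is its own hull; `e⁻¹(e(e⁻¹B)) = e⁻¹B`) and the local Θ-volume is `logvol (thetaRegion3)` — so at such
  places the support clause (b) is read on the Θ-region itself;
* `thetaFinite_ofComparison` — `ThetaFinite` from: `HullDefined` at every `(j ∈ 𝔽_l^⋇, v_ℚ)` (e.g. by descent), the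
  good-place condition at all but finitely many `v_ℚ`, and finite support of `v_ℚ ↦ logvol (thetaRegion3)` — the
  last being exactly the hypothesis `hfinθ` of seat c312-5's `Real.bridgeHyps_settingDHVol` (`Cor312SettingDHVol`);
* `hullDefined_of_isEmpty` — packets with NO field factor (the archimedean place in the Dupuy–Hilado convention of
  c312-5's `Real.realPiecesDH`: empty factor index) satisfy (a) outright.
Every theorem is bookkeeping over c312-7's frozen `Cor312.Setting` fields; the hypotheses are properties of the
binders `R.e` / `R.thetaBox` of `Setting.ofComparison`, to be supplied by their owners (c312-5 `Real.settingDHVol`,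
c312-3 `Ind3Datum`). [claim: Mochizuki2012, status: disputed] for the quoted sentences; [cite: DupuyHilado2025, §4
intro, §4.7, §4.9, (4.10)]. Deliberately NOT here: any assertion that the hypotheses hold in IUT's situation
(the Dupuy–Hilado-level instance over seat c312-5's `Real.settingDHVol` is seat c312-5 (gen 3)'s `Cor312HullDefinedDHVol` /
`Cor312ThetaFiniteDHVol`, with the Θ-boxes of seat c312-3 (gen 4) `Cor312ThetaBoxesDH`; no file `Cor312ThetaFiniteRealDH`
exists — A-0 re-cut of 2026-08-26T01:21:17Z); log-volume values; any judgement.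
-/

noncomputable section

namespace Summit.ABC.IUTFork.Cor312

open Thm311 Literature.IUT.LogThetaLattice

/-! ## 0. Descent along the comparison map gives stability -/

/-- **DESCENT ⟹ STABILITY.** If a bijection `Φ` of `X` is intertwined by `e : X → Y` with an injective self-map
`Ψ` of `Y` (`e (Φ x) = Ψ (e x)`) and `Ψ` maps `Λ ⊆ Y` onto itself, then `Φ` maps `e⁻¹(Λ)` onto itself. (With
c312-5's `GeneratorsPreserve.family` this turns "the (Ind1)/(Ind2) families preserve the completed lattice" into
stability of its preimage in the algebraic packet, without any kernel-saturation statement.) [folklore] -/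
theorem image_preimage_eq_of_semiconj {X Y : Type} {e : X → Y} {Φ : X → X} (hΦ : Function.Surjective Φ)
    {Ψ : Y → Y} (hΨ : Function.Injective Ψ) (h : ∀ x, e (Φ x) = Ψ (e x)) {Λ : Set Y} (hΛ : Ψ '' Λ = Λ) :
    Φ '' (e ⁻¹' Λ) = e ⁻¹' Λ := by
  ext x
  simp only [Set.mem_image, Set.mem_preimage]
  constructor
  · rintro ⟨y, hy, rfl⟩
    rw [h y, ← hΛ]
    exact ⟨e y, hy, rfl⟩
  · intro hx
    obtain ⟨y, rfl⟩ := hΦ x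
    refine ⟨y, ?_, rfl⟩
    rw [← hΛ] at hx
    obtain ⟨z, hz, hzx⟩ := hx
    have hΨ' : Ψ (e y) = Ψ z := by rw [← h, hzx]
    rwa [hΨ hΨ']

/-! ## 1. Over any setting: the union of possible images of a STABLE (Ind3)-region is that region -/

namespace Setting

variable {T : ThetaIndex} {S : Situation T} (P : Setting S)

/-- If the (Ind3)-enlarged Θ-region at `(j, v_ℚ)` is mapped onto itself by every (Ind1)/(Ind2)-family, then
the union of ALL possible images IS that region (the translates by the generated group add nothing,
`sUnion_possibleImages_subset`; the identity translate is there, `thetaRegion3_subset_sUnion`). [folklore] -/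
theorem sUnion_possibleImages_eq_thetaRegion3 {j : T.Label} {vQ : T.VQ}
    (hst : ∀ Φ ∈ S.L.Ind1Family ∪ S.L.Ind2Family, Φ j vQ '' P.thetaRegion3 j vQ = P.thetaRegion3 j vQ) :
    ⋃₀ P.possibleImages j vQ = P.thetaRegion3 j vQ :=
  Set.Subset.antisymm (P.sUnion_possibleImages_subset hst subset_rfl) (P.thetaRegion3_subset_sUnion j vQ)

/-- … so `^{n,∘}𝒰_{j,v_ℚ}` is the hull of the (Ind3)-region itself. [folklore] -/
theorem thetaHull_eq_hull_thetaRegion3 {j : T.Label} {vQ : T.VQ}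
    (hst : ∀ Φ ∈ S.L.Ind1Family ∪ S.L.Ind2Family, Φ j vQ '' P.thetaRegion3 j vQ = P.thetaRegion3 j vQ) :
    P.thetaHull j vQ = (P.frame j vQ).hull (P.thetaRegion3 j vQ) := by
  unfold thetaHull
  rw [P.sUnion_possibleImages_eq_thetaRegion3 hst]

/-- Under `HullDefined` the local Θ-volume is the (real) log-volume of `^{n,∘}𝒰_{j,v_ℚ}`. [folklore] -/
theorem thetaLocal_eq_of_hullDefined {j : T.Label} {vQ : T.VQ} (h : P.HullDefined j vQ) :
    P.thetaLocal j vQ = (((S.D P.n).logvol j vQ (P.thetaHull j vQ) : ℝ) : WithTop ℝ) := by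
  unfold thetaLocal
  rw [if_pos h]

/-- **`ThetaFinite` from its two clauses read on the hulls**: `HullDefined` at every `(j ∈ 𝔽_l^⋇, v_ℚ)` (= seat
c312-4's reading `DisplayXIdReal`, Step (xi-d)) and, per label, finitely many `v_ℚ` with nonzero hull volume.
[folklore] -/
theorem thetaFinite_of_hullDefined (hdef : P.DisplayXIdReal)
    (hsupp : ∀ i : Fin T.lstar, (Function.support fun vQ : T.VQ =>
      (S.D P.n).logvol (labelSucc i) vQ (P.thetaHull (labelSucc i) vQ)).Finite) :
    P.ThetaFinite := by
  refine ⟨P.displayXIdReal_iff.mp hdef, fun i => (hsupp i).subset fun vQ hvQ => ?_⟩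
  simp only [Function.mem_support] at hvQ ⊢
  rwa [P.thetaLocal_eq_of_hullDefined (hdef i vQ), WithTop.untopD_coe] at hvQ

/-- Variant with an eventual formula: if `HullDefined` holds at every `(j ∈ 𝔽_l^⋇, v_ℚ)` and, per label, at all
but finitely many `v_ℚ` the hull volume equals `g v_ℚ` for a finitely supported `g`, then `ThetaFinite`.
[folklore] -/
theorem thetaFinite_of_eventuallyEq (hdef : P.DisplayXIdReal) (g : Fin T.lstar → T.VQ → ℝ)
    (hg : ∀ i : Fin T.lstar, ∀ᶠ vQ in Filter.cofinite,
      (S.D P.n).logvol (labelSucc i) vQ (P.thetaHull (labelSucc i) vQ) = g i vQ)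
    (hsupp : ∀ i : Fin T.lstar, (Function.support (g i)).Finite) : P.ThetaFinite := by
  refine P.thetaFinite_of_hullDefined hdef fun i => ?_
  have hfin := (Filter.eventually_cofinite.mp (hg i)).union (hsupp i)
  refine hfin.subset fun vQ hvQ => ?_
  simp only [Function.mem_support] at hvQ
  simp only [Set.mem_union, Set.mem_setOf_eq, Function.mem_support]
  by_contra hcon
  simp only [not_or, ne_eq, not_not] at hcon
  exact hvQ (hcon.1.trans hcon.2)

end Setting

/-! ## 2. Over settings assembled from real packets (`Setting.ofComparison`) -/

namespace Setting

open Literature.IUT.LogVolume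

variable {T : ThetaIndex} {S : Situation T}
variable (n : ℤ) {HT : Type} {LogLink : HT → HT → Type} {IsFull : ∀ {s t : HT}, LogLink s t → Prop}
  (lat : LGPGaussianLogThetaLattice LogLink IsFull)
  {Frd : Type} {IsoF : Frd → Frd → Type} {Ob : Frd → Type} {realify : Frd → Frd} {Strip : Type}
  {IsoS : Strip → Strip → Type} {M : ∀ v : T.V, v ∈ T.Vbad → Type} [∀ v h, Monoid (M v h)]
  (sig : GlobalLGPFrobenioidSignature T.lstar T.V (· ∈ T.Vbad) Frd IsoF Ob realify Strip IsoS M)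
  (split : SplittingMonoids M) {ObΔ : Type} {N : ∀ v : T.V, v ∈ T.Vbad → Type} [∀ v h, Monoid (N v h)]
  (qData : QPilotData ObΔ N) (R : RealPieces S (Ob sig.Clgp) ObΔ)
  (hq : ∀ j vQ i, R.qCentre (qPilotObject qData) j vQ i ≠ 0)
  (hadm : ∀ j vQ (H : Set (∀ i, R.K j vQ i)), Literature.IUT.LogVolume.IsHullSet (R.K j vQ) H →
    (S.D n).Adm j vQ (R.e j vQ ⁻¹' H))
  (hfin : ∀ j : T.Label, (Function.support fun vQ => (S.D n).logvol j vQ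
    (R.e j vQ ⁻¹' Literature.IUT.LogVolume.hullSet (R.K j vQ) (R.qCentre (qPilotObject qData) j vQ))).Finite)

/-- The (Ind3)-region of the assembled setting is the preimage of the union of the Θ-boxes. [folklore] -/
theorem ofComparison_thetaRegion3 (j : T.Label) (vQ : T.VQ) :
    (ofComparison n lat sig split qData R hq hadm hfin).thetaRegion3 j vQ =
      R.e j vQ ⁻¹' ⋃ m : ℤ, R.thetaBox m (thetaPilotObject sig split) j vQ := by
  unfold Setting.thetaRegion3
  rw [Set.preimage_iUnion]
  rfl

/-- … so its image in `⊕_i K_i` is the part of the union of the Θ-boxes met by the image of `e`. [folklore] -/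
theorem image_thetaRegion3_ofComparison (j : T.Label) (vQ : T.VQ) :
    R.e j vQ '' (ofComparison n lat sig split qData R hq hadm hfin).thetaRegion3 j vQ =
      (⋃ m : ℤ, R.thetaBox m (thetaPilotObject sig split) j vQ) ∩ Set.range (R.e j vQ) := by
  rw [ofComparison_thetaRegion3, Set.image_preimage_eq_inter_range]

/-- With `e` onto (c312-5 `comparison_surjective`: `⊗_ℚ → ⊕_{v⃗} ⊗_{ℚ_p}` is surjective) the image IS the union
of the Θ-boxes. [folklore] -/
theorem image_thetaRegion3_ofComparison_of_surjective (j : T.Label) (vQ : T.VQ)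
    (he : Function.Surjective (R.e j vQ)) :
    R.e j vQ '' (ofComparison n lat sig split qData R hq hadm hfin).thetaRegion3 j vQ =
      ⋃ m : ℤ, R.thetaBox m (thetaPilotObject sig split) j vQ := by
  rw [image_thetaRegion3_ofComparison, he.range_eq, Set.inter_univ]

/-- **`HullDefined` BY DESCENT** ("compactness of `^{n,∘}𝒰_{j,v_ℚ}`", proof of Cor. 3.12 p. 175 l. 2–4; Dupuy–Hilado §4:
the indeterminacies are automorphisms of a fixed lattice): if every (Ind1)/(Ind2)-family descends along the
comparison `e` to an injective self-map of `⊕_i K_i` mapping a BOUNDED `Λ` onto itself, `Λ` contains every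
Θ-box, and the part of the Θ-boxes met by the image of `e` is non-degenerate, then the union of the possible
images at `(j, v_ℚ)` admits its holomorphic hull. PROVED (`hullDefined_of_stable` with `W := e⁻¹(Λ)`).
[claim: Mochizuki2012, status: disputed] -/
theorem hullDefined_of_descent (j : T.Label) (vQ : T.VQ) (Λ : Set (∀ i, R.K j vQ i))
    (hdesc : ∀ Φ ∈ S.L.Ind1Family ∪ S.L.Ind2Family, ∃ Ψ : (∀ i, R.K j vQ i) → ∀ i, R.K j vQ i,
      Function.Injective Ψ ∧ (∀ x, R.e j vQ (Φ j vQ x) = Ψ (R.e j vQ x)) ∧ Ψ '' Λ = Λ)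
    (hΛ : Bornology.IsBounded Λ)
    (hθΛ : ∀ m : ℤ, R.thetaBox m (thetaPilotObject sig split) j vQ ⊆ Λ)
    (hnd : IsNondegenerate (R.K j vQ)
      ((⋃ m : ℤ, R.thetaBox m (thetaPilotObject sig split) j vQ) ∩ Set.range (R.e j vQ))) :
    (ofComparison n lat sig split qData R hq hadm hfin).HullDefined j vQ := by
  refine hullDefined_of_stable n lat sig split qData R hq hadm hfin j vQ (R.e j vQ ⁻¹' Λ) ?_ ?_ ?_ ?_
  · intro Φ hΦ
    obtain ⟨Ψ, hinj, hcomm, hΨΛ⟩ := hdesc Φ hΦ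
    exact image_preimage_eq_of_semiconj (Φ j vQ).surjective hinj hcomm hΨΛ
  · rw [ofComparison_thetaRegion3]
    exact Set.preimage_mono (Set.iUnion_subset hθΛ)
  · exact hΛ.subset (Set.image_preimage_subset _ _)
  · rwa [image_thetaRegion3_ofComparison]

/-- Stability of the (Ind3)-region itself by descent: if the families descend to injections mapping the union
of the Θ-boxes onto itself, they map `thetaRegion3 = e⁻¹(⋃ₘ thetaBox m)` onto itself. [folklore] -/
theorem thetaRegion3_stable_of_descent (j : T.Label) (vQ : T.VQ)
    (hdesc : ∀ Φ ∈ S.L.Ind1Family ∪ S.L.Ind2Family, ∃ Ψ : (∀ i, R.K j vQ i) → ∀ i, R.K j vQ i,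
      Function.Injective Ψ ∧ (∀ x, R.e j vQ (Φ j vQ x) = Ψ (R.e j vQ x)) ∧
        Ψ '' (⋃ m : ℤ, R.thetaBox m (thetaPilotObject sig split) j vQ) =
          ⋃ m : ℤ, R.thetaBox m (thetaPilotObject sig split) j vQ) :
    ∀ Φ ∈ S.L.Ind1Family ∪ S.L.Ind2Family,
      Φ j vQ '' (ofComparison n lat sig split qData R hq hadm hfin).thetaRegion3 j vQ =
        (ofComparison n lat sig split qData R hq hadm hfin).thetaRegion3 j vQ := by
  intro Φ hΦ
  obtain ⟨Ψ, hinj, hcomm, hΨ⟩ := hdesc Φ hΦ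
  rw [ofComparison_thetaRegion3]
  exact image_preimage_eq_of_semiconj (Φ j vQ).surjective hinj hcomm hΨ

/-- **THE GOOD PLACES.** If the (Ind3)-region at `(j, v_ℚ)` is mapped onto itself by every (Ind1)/(Ind2)-family
and its image in `⊕_i K_i` is a hull-set `λ·𝒪_L` (at all but finitely many `v_ℚ` the Θ-pilot region is the trivial
bundle and the indeterminacies fix it), then the union of the possible images admits its hull AND `^{n,∘}𝒰_{j,v_ℚ}`
IS the (Ind3)-region: a hull-set is its own hull, and `e⁻¹(e(e⁻¹B)) = e⁻¹B`. PROVED. [claim: Mochizuki2012, status: disputed] -/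
theorem hullDefined_and_thetaHull_eq_of_isHullSet (j : T.Label) (vQ : T.VQ)
    (hst : ∀ Φ ∈ S.L.Ind1Family ∪ S.L.Ind2Family,
      Φ j vQ '' (ofComparison n lat sig split qData R hq hadm hfin).thetaRegion3 j vQ =
        (ofComparison n lat sig split qData R hq hadm hfin).thetaRegion3 j vQ)
    (hH : IsHullSet (R.K j vQ) (R.e j vQ '' (ofComparison n lat sig split qData R hq hadm hfin).thetaRegion3 j vQ)) :
    (ofComparison n lat sig split qData R hq hadm hfin).HullDefined j vQ ∧
      (ofComparison n lat sig split qData R hq hadm hfin).thetaHull j vQ =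
        (ofComparison n lat sig split qData R hq hadm hfin).thetaRegion3 j vQ := by
  set P := ofComparison n lat sig split qData R hq hadm hfin with hP
  have hb : Bornology.IsBounded (R.e j vQ '' P.thetaRegion3 j vQ) := IsHullSet.isBounded (R.K j vQ) hH
  have hdef : P.HullDefined j vQ :=
    hullDefined_of_stable n lat sig split qData R hq hadm hfin j vQ (P.thetaRegion3 j vQ) hst subset_rfl hb
      (IsHullSet.isNondegenerate (R.K j vQ) hH)
  refine ⟨hdef, ?_⟩
  rw [P.thetaHull_eq_hull_thetaRegion3 hst]
  have hframe : P.frame j vQ = (HullFrame.ofLocalFields (R.K j vQ)).comap (R.e j vQ) := rfl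
  rw [hframe, HullFrame.comap_hull (R.e j vQ) (HullFrame.ofLocalFields (R.K j vQ)) hb]
  have hhull : (HullFrame.ofLocalFields (R.K j vQ)).hull (R.e j vQ '' P.thetaRegion3 j vQ) =
      R.e j vQ '' P.thetaRegion3 j vQ :=
    Set.Subset.antisymm ((HullFrame.ofLocalFields (R.K j vQ)).hull_subset_of_mem hH subset_rfl)
      ((HullFrame.ofLocalFields (R.K j vQ)).subset_hull _)
  rw [hhull, hP, ofComparison_thetaRegion3, Set.image_preimage_eq_inter_range, Set.preimage_inter_range]

/-- … and then the local Θ-volume at `(j, v_ℚ)` is the log-volume of the (Ind3)-region. [folklore] -/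
theorem thetaLocal_eq_logvol_thetaRegion3 (j : T.Label) (vQ : T.VQ)
    (hst : ∀ Φ ∈ S.L.Ind1Family ∪ S.L.Ind2Family,
      Φ j vQ '' (ofComparison n lat sig split qData R hq hadm hfin).thetaRegion3 j vQ =
        (ofComparison n lat sig split qData R hq hadm hfin).thetaRegion3 j vQ)
    (hH : IsHullSet (R.K j vQ) (R.e j vQ '' (ofComparison n lat sig split qData R hq hadm hfin).thetaRegion3 j vQ)) :
    (ofComparison n lat sig split qData R hq hadm hfin).thetaLocal j vQ =
      (((S.D n).logvol j vQ ((ofComparison n lat sig split qData R hq hadm hfin).thetaRegion3 j vQ) : ℝ) :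
        WithTop ℝ) := by
  obtain ⟨hdef, hhull⟩ := hullDefined_and_thetaHull_eq_of_isHullSet n lat sig split qData R hq hadm hfin j vQ hst hH
  rw [(ofComparison n lat sig split qData R hq hadm hfin).thetaLocal_eq_of_hullDefined hdef, hhull]
  rfl

/-- **`ThetaFinite` for an assembled setting** ("`−|log(Θ)| ∈ ℝ`", Cor. 3.12 p. 174 l. 16; proof p. 175 l. 2–4 with
Prop. 3.9 (iii)): from `HullDefined` at every `(j ∈ 𝔽_l^⋇, v_ℚ)` (`hullDefined_of_descent`, `hullDefined_of_isEmpty`),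
the good-place condition at all but finitely many `v_ℚ` per label, and finite support of the log-volumes of the
(Ind3)-regions (the hypothesis `hfinθ` of c312-5's `Real.bridgeHyps_settingDHVol`). PROVED. [claim: Mochizuki2012, status: disputed] -/
theorem thetaFinite_ofComparison (hdef : (ofComparison n lat sig split qData R hq hadm hfin).DisplayXIdReal)
    (hgood : ∀ i : Fin T.lstar, ∀ᶠ vQ in Filter.cofinite,
      (∀ Φ ∈ S.L.Ind1Family ∪ S.L.Ind2Family,
        Φ (labelSucc i) vQ '' (ofComparison n lat sig split qData R hq hadm hfin).thetaRegion3 (labelSucc i) vQ =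
          (ofComparison n lat sig split qData R hq hadm hfin).thetaRegion3 (labelSucc i) vQ) ∧
      IsHullSet (R.K (labelSucc i) vQ)
        (R.e (labelSucc i) vQ '' (ofComparison n lat sig split qData R hq hadm hfin).thetaRegion3 (labelSucc i) vQ))
    (hfinθ : ∀ i : Fin T.lstar, (Function.support fun vQ : T.VQ => (S.D n).logvol (labelSucc i) vQ
      ((ofComparison n lat sig split qData R hq hadm hfin).thetaRegion3 (labelSucc i) vQ)).Finite) :
    (ofComparison n lat sig split qData R hq hadm hfin).ThetaFinite := by
  refine (ofComparison n lat sig split qData R hq hadm hfin).thetaFinite_of_eventuallyEq hdef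
    (fun i vQ => (S.D n).logvol (labelSucc i) vQ
      ((ofComparison n lat sig split qData R hq hadm hfin).thetaRegion3 (labelSucc i) vQ))
    (fun i => (hgood i).mono fun vQ hvQ => ?_) hfinθ
  rw [(hullDefined_and_thetaHull_eq_of_isHullSet n lat sig split qData R hq hadm hfin _ vQ hvQ.1 hvQ.2).2]
  rfl

/-! ## 3. Packets without field factors -/

/-- A packet of the assembled setting whose real side has NO field factor (empty index — the archimedean place in
the convention of c312-5's `Real.realPiecesDH`) satisfies `HullDefined` outright: every subset of the one-point
space `⊕_∅` is bounded, and non-degeneracy is vacuous. [folklore] -/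
theorem hullDefined_of_isEmpty (j : T.Label) (vQ : T.VQ) [IsEmpty (R.J j vQ)] :
    (ofComparison n lat sig split qData R hq hadm hfin).HullDefined j vQ := by
  rw [ofComparison_hullDefined_iff]
  exact ⟨(Set.subsingleton_of_subsingleton.finite).isBounded, fun i => isEmptyElim i⟩

end Setting

end Summit.ABC.IUTFork.Cor312

end
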